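import Summits.NavierStokesRegularity.FluidComputer.AngularGalerkinLadderAdjoint
import Summits.NavierStokesRegularity.FluidComputer.AngularGalerkinLadderRadialCutoff
import HarnessLib

/-!
# The fold range of the mean–wave rung profiles: an `n`-fold azimuthal wave band-limited to
# degree `L < n` vanishes; the angular Bernstein inequality of the Casimir cut
# (route `AngularGalerkinLadder`, crux K1 `RungBlowupCofinal`; Negative lane, theorems only)

Negative-lane bookkeeping for `stmt-NavierStokesRegularity-19959` (K1 of route №8), cell ns-blowup,
refuter5 (K5-74), about the line `Cruxes/RungBlowupCofinal/Lines/qlwave.lean` (mean–wave / exact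
quasi-linear rung profiles `U = V + W`, `V` zonal, `W` an `n`-fold azimuthal wave, `L < 2n`). Nothing
here asserts a Theses declaration; no definition, no named fact. WHAT THIS IS NOT: not Navier–Stokes
evidence — kinematic `L²` facts about smooth compactly supported / band-limited vector fields on `ℝ³`;
no rung dynamics, no profile is constructed or excluded beyond the stated kinematic box.

## Content

* `bandDefect_eq_smul_of_casimir_eq` — on a `𝒞`-eigenfield `𝒞v = μv` every band defect
  `∏_{j ≤ L}(𝒞 − j(j+1))` acts by the scalar `∏_{j ≤ L}(μ − j(j+1))`.
* **`integral_inner_casimir_le` (angular Bernstein inequality)** — for `w` band-limited of degree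
  `≤ L` with compact support, `∫⟪𝒞w, w⟫ ≤ L(L+1) ∫‖w‖²`, i.e. `Σ_a ‖J_a w‖²_{L²} ≤ L(L+1)‖w‖²_{L²}`
  (`sum_integral_norm_sq_angGen_le`, `integral_norm_sq_angGen_le`). Proof by induction on `L` with no
  spectral theorem: `w₁ := ∏_{j ≤ L}(𝒞 − j(j+1)) w` is a `𝒞`-eigenfield of eigenvalue `(L+1)(L+2)` when
  `w` is band-limited of degree `≤ L+1`; `w₂ := w − w₁/∏_{j ≤ L}((L+1)(L+2) − j(j+1))` is band-limited
  of degree `≤ L`; the two pieces are `L²`-orthogonal by the symmetry of the band defects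
  (`integral_inner_bandDefect_comm`), and `𝒞` splits accordingly.
* `sq_mul_integral_le_integral_inner_casimir` — for a field with `J₃(J₃w) = −ν w` (compact support),
  `ν ∫‖w‖² = ‖J₃w‖²_{L²} ≤ ∫⟪𝒞w, w⟫` (skew-adjointness of `J₃`).
* **`eq_zero_of_isBandLimited_of_azimuthalWave`** — an `n`-fold azimuthal wave
  (`J₃(J₃W) = −n²W` pointwise, the letter of `Qlwave.IsAzimuthalWave n W`) which is band-limited of
  degree `L < n` is identically zero (radial cut-off `χ(‖x‖²)W`, then `n² ≤ L(L+1)` is impossible);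
  `fold_le_of_ne_zero`: a non-zero one has `n ≤ L`; `eq_zero_of_isBandLimited_zero_of_azimuthalWave`:
  none at rung `0`.

Reading for the line: conjuncts `IsBandLimited L W` and `IsAzimuthalWave n W` of
`Qlwave.IsMeanWaveProfile L n α C V W Q₀ Q₁ E₀ E₁` together with the witness clause `∃ y, W y ≠ 0` force
`n ≤ L`; with the line's `L < 2n` every witness of `stub_meanwave_profiles_cofinal` uses a fold
`n ∈ (L/2, L]` (the sectoral choice `n = L` is admissible), and the witness class is EMPTY at `L = 0`
independently of any dynamics (consistent with `RungZeroNotSingular`). [cite: BullardGellman1954]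
(vector spherical harmonics: `𝒞 = j(j+1)`, `|m| ≤ j` on the degree-`j` isotype — here in the tree's
projection-free typing).
-/

noncomputable section

namespace Summit.NavierStokesRegularity.AngularGalerkinLadderMeanWaveFoldRange

open Set Function MeasureTheory
open scoped ContDiff RealInnerProductSpace
open Literature.Analysis.FluidPDE
open Summit.NavierStokesRegularity.FluidComputer
open Summit.NavierStokesRegularity.FluidComputer.AngularLadder

variable {v w : EuclideanSpace ℝ (Fin 3) → EuclideanSpace ℝ (Fin 3)} {L : ℕ}

/-! ## §1 Band defects of Casimir eigenfields -/

/-- On a smooth `𝒞`-eigenfield, `𝒞v = μ v`, the band defect `∏_{j ≤ L}(𝒞 − j(j+1))` acts by the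
scalar `∏_{j ≤ L}(μ − j(j+1))`. [folklore] -/
theorem bandDefect_eq_smul_of_casimir_eq (hv : ContDiff ℝ ∞ v) {μ : ℝ} (hμ : casimir v = μ • v)
    (L : ℕ) :
    bandDefect L v = (∏ j ∈ Finset.range (L + 1), (μ - (j : ℝ) * ((j : ℝ) + 1))) • v := by
  induction L with
  | zero =>
      funext x
      change casimir v x = _
      rw [hμ, zero_add, Finset.prod_range_one]
      simp only [Nat.cast_zero, zero_mul, sub_zero]
  | succ L ih =>
      funext x
      change casimir (bandDefect L v) x - (((L : ℝ) + 1) * ((L : ℝ) + 2)) • bandDefect L v x = _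
      rw [ih, casimir_smul hv, hμ,
        Finset.prod_range_succ (fun j => μ - (j : ℝ) * ((j : ℝ) + 1)) (L + 1)]
      simp only [Pi.smul_apply, smul_smul, ← sub_smul]
      congr 1
      push_cast
      ring

/-- The gaps `(L+1)(L+2) − j(j+1)`, `j ≤ L`, are positive, and so is their product. [folklore] -/
theorem prod_casimirGap_pos (L : ℕ) :
    0 < ∏ j ∈ Finset.range (L + 1),
      ((((L : ℝ) + 1) * ((L : ℝ) + 2)) - (j : ℝ) * ((j : ℝ) + 1)) := by
  refine Finset.prod_pos fun j hj => ?_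
  have hjL : (j : ℝ) ≤ L := by exact_mod_cast Nat.lt_succ_iff.mp (Finset.mem_range.mp hj)
  have hj0 : (0 : ℝ) ≤ j := Nat.cast_nonneg j
  have hL0 : (0 : ℝ) ≤ L := Nat.cast_nonneg L
  nlinarith [mul_nonneg (sub_nonneg.2 hjL) hj0, mul_nonneg (sub_nonneg.2 hjL) hL0]

/-! ## §2 The angular Bernstein inequality of the Casimir cut -/

/-- **Angular Bernstein inequality**: for a compactly supported field band-limited of degree `≤ L`,
`∫⟪𝒞w, w⟫ ≤ L(L+1) ∫‖w‖²` — on `ran Π_L` the Casimir is bounded by its top eigenvalue `L(L+1)`.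
Induction on `L`, splitting `w` into the `(L+1)(L+2)`-eigenfield `∏_{j ≤ L}(𝒞 − j(j+1)) w` and an
`L²`-orthogonal remainder of degree `≤ L`. [cite: BullardGellman1954] -/
theorem integral_inner_casimir_le (hw : IsBandLimited L w) (hwc : HasCompactSupport w) :
    ∫ x, ⟪casimir w x, w x⟫ ≤ ((L : ℝ) * ((L : ℝ) + 1)) * ∫ x, ‖w x‖ ^ 2 := by
  induction L generalizing w with
  | zero =>
      have h : ∀ x, casimir w x = 0 := hw.2
      simp only [h, inner_zero_left, integral_zero, Nat.cast_zero, zero_mul, le_refl]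
  | succ L ih =>
      obtain ⟨lam, hlam⟩ : ∃ lam : ℝ, lam = ((L : ℝ) + 1) * ((L : ℝ) + 2) := ⟨_, rfl⟩
      obtain ⟨p, hp⟩ : ∃ p : ℝ, p = ∏ j ∈ Finset.range (L + 1), (lam - (j : ℝ) * ((j : ℝ) + 1)) :=
        ⟨_, rfl⟩
      have hp0 : 0 < p := by rw [hp, hlam]; exact prod_casimirGap_pos L
      -- the top isotypic piece `w₁ = ∏_{j ≤ L}(𝒞 − j(j+1)) w`
      obtain ⟨w₁, hw₁⟩ : ∃ w₁ : EuclideanSpace ℝ (Fin 3) → EuclideanSpace ℝ (Fin 3),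
          w₁ = bandDefect L w := ⟨_, rfl⟩
      have hws : ContDiff ℝ ∞ w := hw.1
      have hw₁s : ContDiff ℝ ∞ w₁ := hw₁ ▸ contDiff_bandDefect hws L
      have hw₁c : HasCompactSupport w₁ := hw₁ ▸ hasCompactSupport_bandDefect hwc L
      have hC₁ : casimir w₁ = lam • w₁ := by
        funext x
        have h : casimir (bandDefect L w) x -
            (((L : ℝ) + 1) * ((L : ℝ) + 2)) • bandDefect L w x = 0 := hw.2 x
        rw [← hw₁, ← hlam, sub_eq_zero] at h
        rw [h, Pi.smul_apply]
      have hB₁ : bandDefect L w₁ = p • w₁ := by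
        rw [hp]; exact bandDefect_eq_smul_of_casimir_eq hw₁s hC₁ L
      -- the remainder `w₂ = w − p⁻¹ w₁`, band-limited of degree `≤ L`
      obtain ⟨c, hc⟩ : ∃ c : ℝ, c = p⁻¹ := ⟨_, rfl⟩
      have hcp : c * p = 1 := by rw [hc]; exact inv_mul_cancel₀ hp0.ne'
      obtain ⟨w₂, hw₂⟩ : ∃ w₂ : EuclideanSpace ℝ (Fin 3) → EuclideanSpace ℝ (Fin 3),
          w₂ = w + (-c) • w₁ := ⟨_, rfl⟩
      have hw₁sc : ContDiff ℝ ∞ ((-c) • w₁) := hw₁s.const_smul (-c)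
      have hw₂s : ContDiff ℝ ∞ w₂ := hw₂ ▸ hws.add hw₁sc
      have hw₁cc : HasCompactSupport ((-c) • w₁) :=
        hw₁c.comp_left (g := fun z : EuclideanSpace ℝ (Fin 3) => (-c) • z) (smul_zero _)
      have hw₂c : HasCompactSupport w₂ := hw₂ ▸ hwc.add hw₁cc
      have hw₂B : IsBandLimited L w₂ := by
        refine ⟨hw₂s, fun x => ?_⟩
        rw [hw₂, bandDefect_add hws hw₁sc L, bandDefect_smul hw₁s (-c) L, hB₁, ← hw₁]
        simp only [Pi.add_apply, Pi.smul_apply, smul_smul]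
        rw [show -c * p = -1 by rw [neg_mul, hcp], neg_one_smul, add_neg_cancel]
      -- orthogonality `∫⟪w₁, w₂⟫ = 0` by the symmetry of the band defects
      have horth : ∫ x, ⟪w₁ x, w₂ x⟫ = 0 := by
        have h1 := integral_inner_bandDefect_comm hw₁s L hw₂s hw₂c
        have h0 : ∀ x, bandDefect L w₂ x = 0 := hw₂B.2
        simp only [h0, inner_zero_right, integral_zero, hB₁, Pi.smul_apply,
          real_inner_smul_left] at h1
        rw [integral_const_mul] at h1
        exact (mul_eq_zero.1 h1).resolve_left hp0.ne'
      have hsym : ∀ x, ⟪w₂ x, w₁ x⟫ = ⟪w₁ x, w₂ x⟫ := fun x => real_inner_comm (w₁ x) (w₂ x)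
      -- pointwise decompositions of `w` and `𝒞w`
      have hwx : ∀ x, w x = w₂ x + c • w₁ x := fun x => by
        rw [hw₂, Pi.add_apply, Pi.smul_apply, add_assoc, neg_smul, neg_add_cancel, add_zero]
      have hw_eq : w = w₂ + c • w₁ := funext fun x => by rw [hwx x]; rfl
      have hcw₁s : ContDiff ℝ ∞ (c • w₁) := hw₁s.const_smul c
      have hCw : ∀ x, casimir w x = casimir w₂ x + (c * lam) • w₁ x := fun x => by
        rw [hw_eq, casimir_add hw₂s hcw₁s, casimir_smul hw₁s c, hC₁]
        simp only [Pi.add_apply, Pi.smul_apply, smul_smul]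
      -- integrability bookkeeping (continuous integrands, compact supports)
      have hw₁co : Continuous w₁ := hw₁s.continuous
      have hw₂co : Continuous w₂ := hw₂s.continuous
      have hC₂co : Continuous (casimir w₂) := (contDiff_casimir hw₂s).continuous
      have i22 : Integrable fun x => ⟪casimir w₂ x, w₂ x⟫ :=
        integrable_inner_of_hasCompactSupport_right hC₂co hw₂co hw₂c
      have i21 : Integrable fun x => ⟪casimir w₂ x, w₁ x⟫ :=
        integrable_inner_of_hasCompactSupport_right hC₂co hw₁co hw₁c
      have i12 : Integrable fun x => ⟪w₁ x, w₂ x⟫ :=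
        integrable_inner_of_hasCompactSupport_right hw₁co hw₂co hw₂c
      have i11 : Integrable fun x => ⟪w₁ x, w₁ x⟫ :=
        integrable_inner_of_hasCompactSupport_right hw₁co hw₁co hw₁c
      have i22' : Integrable fun x => ⟪w₂ x, w₂ x⟫ :=
        integrable_inner_of_hasCompactSupport_right hw₂co hw₂co hw₂c
      -- the cross term `∫⟪𝒞w₂, w₁⟫ = lam ∫⟪w₂, w₁⟫ = 0`
      have hcross : ∫ x, ⟪casimir w₂ x, w₁ x⟫ = 0 := by
        rw [integral_inner_casimir_comm hw₂s hw₁s hw₁c, hC₁]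
        simp only [Pi.smul_apply, real_inner_smul_right, hsym]
        rw [integral_const_mul, horth, mul_zero]
      -- expand `∫⟪𝒞w, w⟫` and `∫‖w‖²` along the orthogonal splitting
      have hL : ∫ x, ⟪casimir w x, w x⟫ =
          (∫ x, ⟪casimir w₂ x, w₂ x⟫) + (c * (c * lam)) * ∫ x, ⟪w₁ x, w₁ x⟫ := by
        have hpt : ∀ x, ⟪casimir w x, w x⟫ =
            (⟪casimir w₂ x, w₂ x⟫ + c * ⟪casimir w₂ x, w₁ x⟫) +
              ((c * lam) * ⟪w₁ x, w₂ x⟫ + (c * (c * lam)) * ⟪w₁ x, w₁ x⟫) := fun x => by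
          rw [hCw x, hwx x]
          simp only [inner_add_left, inner_add_right, real_inner_smul_left, real_inner_smul_right]
          ring
        have iQ : Integrable fun x => c * ⟪casimir w₂ x, w₁ x⟫ := i21.const_mul c
        have iR : Integrable fun x => (c * lam) * ⟪w₁ x, w₂ x⟫ := i12.const_mul _
        have iS : Integrable fun x => (c * (c * lam)) * ⟪w₁ x, w₁ x⟫ := i11.const_mul _
        have iA : Integrable fun x => ⟪casimir w₂ x, w₂ x⟫ + c * ⟪casimir w₂ x, w₁ x⟫ :=
          i22.add iQ
        have iB : Integrable fun x =>
            (c * lam) * ⟪w₁ x, w₂ x⟫ + (c * (c * lam)) * ⟪w₁ x, w₁ x⟫ := iR.add iS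
        simp_rw [hpt]
        rw [integral_add iA iB, integral_add i22 iQ, integral_add iR iS, integral_const_mul,
          integral_const_mul, integral_const_mul, hcross, horth]
        ring
      have hR : ∫ x, ‖w x‖ ^ 2 = (∫ x, ⟪w₂ x, w₂ x⟫) + (c * c) * ∫ x, ⟪w₁ x, w₁ x⟫ := by
        have hpt : ∀ x, ‖w x‖ ^ 2 =
            (⟪w₂ x, w₂ x⟫ + (2 * c) * ⟪w₁ x, w₂ x⟫) + (c * c) * ⟪w₁ x, w₁ x⟫ := fun x => by
          rw [← real_inner_self_eq_norm_sq, hwx x]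
          simp only [inner_add_left, inner_add_right, real_inner_smul_left, real_inner_smul_right,
            hsym x]
          ring
        have iX : Integrable fun x => (2 * c) * ⟪w₁ x, w₂ x⟫ := i12.const_mul _
        have iS : Integrable fun x => (c * c) * ⟪w₁ x, w₁ x⟫ := i11.const_mul _
        have iA : Integrable fun x => ⟪w₂ x, w₂ x⟫ + (2 * c) * ⟪w₁ x, w₂ x⟫ := i22'.add iX
        simp_rw [hpt]
        rw [integral_add iA iS, integral_add i22' iX, integral_const_mul, integral_const_mul, horth]
        ring
      -- conclude with the induction hypothesis on `w₂` and `L(L+1) ≤ lam`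
      have hih := ih hw₂B hw₂c
      have hn2 : ∫ x, ‖w₂ x‖ ^ 2 = ∫ x, ⟪w₂ x, w₂ x⟫ := by
        simp_rw [real_inner_self_eq_norm_sq]
      rw [hn2] at hih
      have hI2 : 0 ≤ ∫ x, ⟪w₂ x, w₂ x⟫ := integral_nonneg fun _ => real_inner_self_nonneg
      have hI1 : 0 ≤ ∫ x, ⟪w₁ x, w₁ x⟫ := integral_nonneg fun _ => real_inner_self_nonneg
      have hL0 : (0 : ℝ) ≤ L := Nat.cast_nonneg L
      have hlamL : (L : ℝ) * ((L : ℝ) + 1) ≤ lam := by rw [hlam]; nlinarith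
      have hkey := mul_le_mul_of_nonneg_right hlamL hI2
      rw [hL, hR]
      subst hlam
      push_cast
      nlinarith [hih, hkey, hI1, sq_nonneg c, mul_nonneg (mul_nonneg (sq_nonneg c) hI1) hL0]

/-- The angular Bernstein inequality for the generators: `Σ_a ∫‖J_a w‖² ≤ L(L+1) ∫‖w‖²` for a
compactly supported field band-limited of degree `≤ L`. [cite: BullardGellman1954] -/
theorem sum_integral_norm_sq_angGen_le (hw : IsBandLimited L w) (hwc : HasCompactSupport w) :
    ∑ a : Fin 3, ∫ x, ‖angGen a w x‖ ^ 2 ≤ ((L : ℝ) * ((L : ℝ) + 1)) * ∫ x, ‖w x‖ ^ 2 := by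
  rw [← integral_inner_casimir_self hw.1 hwc]
  exact integral_inner_casimir_le hw hwc

/-- Each generator separately: `∫‖J_a w‖² ≤ L(L+1) ∫‖w‖²` for a compactly supported field
band-limited of degree `≤ L`. [cite: BullardGellman1954] -/
theorem integral_norm_sq_angGen_le (hw : IsBandLimited L w) (hwc : HasCompactSupport w)
    (a : Fin 3) :
    ∫ x, ‖angGen a w x‖ ^ 2 ≤ ((L : ℝ) * ((L : ℝ) + 1)) * ∫ x, ‖w x‖ ^ 2 :=
  (Finset.single_le_sum (f := fun b : Fin 3 => ∫ x, ‖angGen b w x‖ ^ 2)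
      (fun _ _ => integral_nonneg fun _ => sq_nonneg _) (Finset.mem_univ a)).trans
    (sum_integral_norm_sq_angGen_le hw hwc)

/-! ## §3 Azimuthal waves: the lower bound and the fold range -/

/-- For a smooth compactly supported field with `J₃(J₃ w) = −ν w` pointwise,
`ν ∫‖w‖² = ∫‖J₃ w‖² ≤ ∫⟪𝒞w, w⟫` (skew-adjointness of `J₃`; the other two generators contribute
non-negative terms). [folklore] -/
theorem sq_mul_integral_le_integral_inner_casimir (hws : ContDiff ℝ ∞ w) (hwc : HasCompactSupport w)
    {ν : ℝ} (hwave : ∀ y, angGen 2 (angGen 2 w) y = -(ν • w y)) :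
    ν * ∫ x, ‖w x‖ ^ 2 ≤ ∫ x, ⟪casimir w x, w x⟫ := by
  rw [integral_inner_casimir_self hws hwc]
  have hJs : ContDiff ℝ ∞ (angGen 2 w) := contDiff_angGen hws 2
  have hJc : HasCompactSupport (angGen 2 w) := hasCompactSupport_angGen hwc 2
  have h2 : ∫ x, ‖angGen 2 w x‖ ^ 2 = ν * ∫ x, ‖w x‖ ^ 2 := by
    have h := integral_inner_angGen_eq_neg hws hJs hJc 2
    simp_rw [real_inner_self_eq_norm_sq, hwave, inner_neg_right, real_inner_smul_right,
      real_inner_self_eq_norm_sq, integral_neg, neg_neg] at h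
    rw [h, integral_const_mul]
  rw [← h2]
  exact Finset.single_le_sum (f := fun a : Fin 3 => ∫ x, ‖angGen a w x‖ ^ 2)
    (fun _ _ => integral_nonneg fun _ => sq_nonneg _) (Finset.mem_univ 2)

/-- **No `n`-fold azimuthal wave is band-limited below degree `n`.** If `W` is band-limited of degree
`≤ L` and `J₃(J₃ W) = −n² W` pointwise (the letter of `Qlwave.IsAzimuthalWave n W`) with `L < n`,
then `W = 0`: cut off radially (`χ(‖x‖²) W` keeps both properties and gains compact support), and
compare `n² ∫‖w‖² ≤ ∫⟪𝒞w, w⟫ ≤ L(L+1) ∫‖w‖²` with `L(L+1) < n²`. [cite: BullardGellman1954] -/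
theorem eq_zero_of_isBandLimited_of_azimuthalWave {n : ℕ}
    {W : EuclideanSpace ℝ (Fin 3) → EuclideanSpace ℝ (Fin 3)} (hW : IsBandLimited L W)
    (hwave : ∀ y, angGen 2 (angGen 2 W) y = -(((n : ℝ) ^ 2) • W y)) (hLn : L < n) : W = 0 := by
  funext x₀
  let φ : ContDiffBump (‖x₀‖ ^ 2) := ⟨1, 2, one_pos, one_lt_two⟩
  have hφs : ContDiff ℝ ∞ (φ : ℝ → ℝ) := φ.contDiff
  have hφd : Differentiable ℝ (φ : ℝ → ℝ) := hφs.differentiable (by simp)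
  obtain ⟨w, hw⟩ : ∃ w : EuclideanSpace ℝ (Fin 3) → EuclideanSpace ℝ (Fin 3),
      w = fun x => φ (‖x‖ ^ 2) • W x := ⟨_, rfl⟩
  have hwB : IsBandLimited L w := by rw [hw]; exact hW.radial_smul hφs
  have hwc : HasCompactSupport w := by
    rw [hw]; exact hasCompactSupport_radial_smul φ.hasCompactSupport W
  have hWd : Differentiable ℝ W := hW.1.differentiable (by simp)
  have hJWd : Differentiable ℝ (angGen 2 W) := (contDiff_angGen hW.1 2).differentiable (by simp)
  have hwave' : ∀ y, angGen 2 (angGen 2 w) y = -(((n : ℝ) ^ 2) • w y) := fun y => by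
    rw [hw, angGen_radial_smul hφd hWd 2, angGen_radial_smul hφd hJWd 2]
    simp only [hwave y, smul_neg, smul_comm (φ (‖y‖ ^ 2)) ((n : ℝ) ^ 2) (W y)]
  have hlow := sq_mul_integral_le_integral_inner_casimir hwB.1 hwc hwave'
  have hup := integral_inner_casimir_le hwB hwc
  have hI0 : 0 ≤ ∫ x, ‖w x‖ ^ 2 := integral_nonneg fun _ => sq_nonneg _
  have hgap : (L : ℝ) * ((L : ℝ) + 1) < (n : ℝ) ^ 2 := by
    have h1 : (L : ℝ) + 1 ≤ n := by exact_mod_cast hLn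
    have hL0 : (0 : ℝ) ≤ L := Nat.cast_nonneg L
    nlinarith
  have hI : ∫ x, ‖w x‖ ^ 2 = 0 := by
    by_contra hne
    have hpos : 0 < ∫ x, ‖w x‖ ^ 2 := lt_of_le_of_ne hI0 (Ne.symm hne)
    have hle := hlow.trans hup
    nlinarith
  -- `∫‖w‖² = 0` with a continuous compactly supported integrand forces `w ≡ 0`
  have hwco : Continuous w := hwB.1.continuous
  have hFc : Continuous fun y => ‖w y‖ ^ 2 := hwco.norm.pow 2
  have hFs : HasCompactSupport fun y => ‖w y‖ ^ 2 :=
    hwc.norm.comp_left (g := fun r : ℝ => r ^ 2) (by simp)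
  have hFi : Integrable fun y => ‖w y‖ ^ 2 := hFc.integrable_of_hasCompactSupport hFs
  have hae := (integral_eq_zero_iff_of_nonneg (fun y => sq_nonneg _) hFi).1 hI
  have heq : (fun y => ‖w y‖ ^ 2) = 0 := (hFc.ae_eq_iff_eq volume continuous_const).1 hae
  have hy := congrFun heq x₀
  simp only [Pi.zero_apply, ne_eq, OfNat.ofNat_ne_zero, not_false_eq_true, pow_eq_zero_iff,
    norm_eq_zero] at hy
  have h1 : φ (‖x₀‖ ^ 2) = 1 :=
    φ.one_of_mem_closedBall (Metric.mem_closedBall_self φ.rIn_pos.le)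
  have hxw : w x₀ = W x₀ := by rw [hw]; simp only [h1, one_smul]
  rw [← hxw, hy, Pi.zero_apply]

/-- **Fold range**: a band-limited field of degree `≤ L` which is a NON-ZERO `n`-fold azimuthal wave
has `n ≤ L`. For the mean–wave rung profiles of `Lines/qlwave.lean` (`L < 2n`) every witness therefore
uses a fold `n ∈ (L/2, L]`. [cite: BullardGellman1954] -/
theorem fold_le_of_ne_zero {n : ℕ} {W : EuclideanSpace ℝ (Fin 3) → EuclideanSpace ℝ (Fin 3)}
    (hW : IsBandLimited L W) (hwave : ∀ y, angGen 2 (angGen 2 W) y = -(((n : ℝ) ^ 2) • W y))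
    (hne : ∃ y, W y ≠ 0) : n ≤ L := by
  by_contra h
  obtain ⟨y, hy⟩ := hne
  exact hy (by rw [eq_zero_of_isBandLimited_of_azimuthalWave hW hwave (not_le.1 h)]; rfl)

/-- **No azimuthal wave at rung zero**: a field band-limited of degree `0` with `J₃(J₃ W) = −n² W`,
`n ≥ 1`, vanishes — the mean–wave witness class of `Lines/qlwave.lean` is empty at `L = 0`
independently of any dynamics. [cite: BullardGellman1954] -/
theorem eq_zero_of_isBandLimited_zero_of_azimuthalWave {n : ℕ}
    {W : EuclideanSpace ℝ (Fin 3) → EuclideanSpace ℝ (Fin 3)} (hW : IsBandLimited 0 W)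
    (hwave : ∀ y, angGen 2 (angGen 2 W) y = -(((n : ℝ) ^ 2) • W y)) (hn : 1 ≤ n) : W = 0 :=
  eq_zero_of_isBandLimited_of_azimuthalWave hW hwave hn

end Summit.NavierStokesRegularity.AngularGalerkinLadderMeanWaveFoldRange

end
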